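import Summits.MatrixMultiplication.MatrixMultiplication.Theses.NilCoxeterShadow
import Literature.RepresentationTheory.FiniteGroups.WedderburnBlocks
import Literature.Computability.AlgebraicComplexity.GroupAlgebraTensor
import Literature.Computability.AlgebraicComplexity.TensorRestrictionRank
import Literature.Computability.AlgebraicComplexity.KroneckerRank

/-!
# Route NilCoxeterShadow — support item `OmegaTwoGroupAlgebraRank` (stmt-MatrixMultiplication-0962)

`ω(ℂ) = 2 → ∀ ε > 0, ∃ C, ∀ finite groups G, R(T_{ℂ[G]}) ≤ C · |G|^{1+ε}` (folklore;
Bürgisser–Clausen–Shokrollahi 1997, Ch. 15; Cohn–Umans 2003, §2 for the converse use).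

Proof, entirely from the tree:

* Wedderburn: `ℂ[G] ≃ₐ[ℂ] ∏ᵢ ℂ^{dᵢ×dᵢ}` with `dᵢ ≥ 1`
  (`Literature.RepresentationTheory.FiniteGroups.exists_algEquiv_pi_matrix`) and `∑ᵢ dᵢ² = |G|`
  (`sum_sq_blockDegrees_eq_card`);
* block bound `R(T_{ℂ[G]}) ≤ ∑ᵢ R(⟨dᵢ,dᵢ,dᵢ⟩)`: the case `N = 1` of
  `tensorRank_groupTensor_pi_le_of_algEquiv` (`GroupAlgebraTensor.lean`), after identifying
  `T_{ℂ[G¹]}` with `T_{ℂ[G]}` by the relabelling `G¹ ≃ G` (`tensorRank_reindex`);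
* `ω` is an exponent: `R(⟨a,a,a⟩) ≤ C · a^{ω+2ε} = C · a^{2+2ε}` for `a ≥ 1`
  (`exists_tensorRank_matMulTensor_le_rpow`);
* `dᵢ² ≤ ∑ⱼ dⱼ² = |G|`, so `∑ᵢ C dᵢ^{2+2ε} ≤ C |G|^ε ∑ᵢ dᵢ² = C |G|^{1+ε}`.
-/

-- the tree's namespace `Summit.MatrixMultiplication.MatrixMultiplication.…` repeats a component by design
set_option linter.dupNamespace false

namespace Summit.MatrixMultiplication.MatrixMultiplication.Theorems

open scoped BigOperators
open Literature.Computability.AlgebraicComplexity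
open Literature.RepresentationTheory.FiniteGroups

/-- The structure tensor of `K[G¹]` (`G¹ = Fin 1 → G`) is the structure tensor of `K[G]` relabelled
along `G¹ ≃ G`, `f ↦ f 0`. [folklore] -/
theorem groupTensor_funUnique {K : Type*} [CommSemiring K] (G : Type*) [Mul G] [DecidableEq G] :
    groupTensor K (Fin 1 → G) = fun z x y =>
      groupTensor K G (Equiv.funUnique (Fin 1) G z) (Equiv.funUnique (Fin 1) G x)
        (Equiv.funUnique (Fin 1) G y) := by
  funext z x y
  simp only [groupTensor_apply, Equiv.funUnique_apply]
  refine if_congr ⟨fun h => ?_, fun h => ?_⟩ rfl rfl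
  · exact (congrFun h default : (x * y) default = z default)
  · funext i
    obtain rfl : i = default := Unique.eq_default i
    exact h

/-- `R(T_{K[G¹]}) = R(T_{K[G]})` (relabelling, Bläser 2013, Lemma 5.4). [folklore] -/
theorem tensorRank_groupTensor_funUnique {K : Type*} [CommSemiring K] (G : Type*) [Mul G]
    [DecidableEq G] :
    tensorRank (groupTensor K (Fin 1 → G)) = tensorRank (groupTensor K G) := by
  rw [groupTensor_funUnique G]
  exact tensorRank_reindex _ _ _ _

/-- **Wedderburn block bound for the rank of a group algebra**: for every algebra isomorphism
`φ : ℂ[G] ≃ₐ[ℂ] ∏_{i<r} ℂ^{dᵢ×dᵢ}` (`dᵢ ≥ 1`), `R(T_{ℂ[G]}) ≤ ∑ᵢ R(⟨dᵢ, dᵢ, dᵢ⟩)` — the case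
`N = 1` of `tensorRank_groupTensor_pi_le_of_algEquiv` (Cohn–Umans 2003, proof of Thm. 4.1,
"taking the rank of both sides" of `ℂ[G] ≃ ⊕ᵢ ⟨dᵢ,dᵢ,dᵢ⟩`). [folklore] -/
theorem tensorRank_groupTensor_le_sum_blocks {G : Type} [Group G] [DecidableEq G] {r : ℕ}
    {d : Fin r → ℕ} [∀ i, NeZero (d i)] (φ : MonoidAlgebra ℂ G ≃ₐ[ℂ] BlockAlgebra ℂ d) :
    tensorRank (groupTensor ℂ G) ≤ ∑ i : Fin r, tensorRank (matMulTensor ℂ (d i) (d i) (d i)) := by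
  have h := tensorRank_groupTensor_pi_le_of_algEquiv ℂ d φ 1
  rw [tensorRank_groupTensor_funUnique G] at h
  refine h.trans (le_of_eq ?_)
  refine Fintype.sum_equiv (Equiv.funUnique (Fin 1) (Fin r)) _ _ fun J => ?_
  rw [Fin.prod_univ_one]
  rfl

/-- **`OmegaTwoGroupAlgebraRank`** (route NilCoxeterShadow, support item
stmt-MatrixMultiplication-0962): `ω(ℂ) = 2` implies that for every `ε > 0` there is `C` with
`R(T_{ℂ[G]}) ≤ C · |G|^{1+ε}` for all finite groups `G`. Wedderburn blocks `dᵢ` with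
`∑ dᵢ² = |G|`, the block bound `R(T_{ℂ[G]}) ≤ ∑ᵢ R(⟨dᵢ,dᵢ,dᵢ⟩)`, `R(⟨d,d,d⟩) ≤ C d^{2+2ε}`
(`ω = 2` is an infimum of exponents) and `dᵢ² ≤ |G|`. [folklore] -/
theorem omegaTwoGroupAlgebraRank_proof :
    Summit.MatrixMultiplication.MatrixMultiplication.Theses.NilCoxeterShadow.OmegaTwoGroupAlgebraRank := by
  unfold Summit.MatrixMultiplication.MatrixMultiplication.Theses.NilCoxeterShadow.OmegaTwoGroupAlgebraRank
  intro hMM ε hε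
  have hω : omega ℂ = 2 := hMM
  obtain ⟨C, hC, hCa⟩ :=
    exists_tensorRank_matMulTensor_le_rpow ℂ (show (0 : ℝ) < 2 * ε by linarith)
  refine ⟨C, fun G _ _ _ => ?_⟩
  -- Wedderburn decomposition of `ℂ[G]`
  obtain ⟨r, d, hd, ⟨φ⟩⟩ := exists_algEquiv_pi_matrix G
  have hsum : ∑ i, d i ^ 2 = Fintype.card G := by
    rw [sum_sq_blockDegrees_eq_card φ, Nat.card_eq_fintype_card]
  have hblocks : tensorRank (groupTensor ℂ G) ≤
      ∑ i : Fin r, tensorRank (matMulTensor ℂ (d i) (d i) (d i)) :=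
    tensorRank_groupTensor_le_sum_blocks φ
  have hGpos : (0 : ℝ) < Fintype.card G := by exact_mod_cast Fintype.card_pos
  -- `dᵢ² ≤ |G|`
  have hdi : ∀ i, (d i : ℝ) ^ 2 ≤ Fintype.card G := fun i => by
    have h : d i ^ 2 ≤ ∑ j, d j ^ 2 :=
      Finset.single_le_sum (fun j _ => Nat.zero_le (d j ^ 2)) (Finset.mem_univ i)
    rw [hsum] at h
    exact_mod_cast h
  -- each block: `R(⟨dᵢ,dᵢ,dᵢ⟩) ≤ C dᵢ^{2+2ε} ≤ C |G|^ε dᵢ²`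
  have hblock : ∀ i, (tensorRank (matMulTensor ℂ (d i) (d i) (d i)) : ℝ) ≤
      C * (Fintype.card G : ℝ) ^ ε * (d i : ℝ) ^ 2 := fun i => by
    have h1 := hCa (d i) NeZero.one_le
    rw [hω] at h1
    have hdpos : (0 : ℝ) < d i := by exact_mod_cast Nat.pos_of_neZero (d i)
    have h2 : (d i : ℝ) ^ (2 + 2 * ε) = (d i : ℝ) ^ 2 * ((d i : ℝ) ^ 2) ^ ε := by
      rw [Real.rpow_add hdpos, Real.rpow_mul hdpos.le, Real.rpow_two]
    have h3 : ((d i : ℝ) ^ 2) ^ ε ≤ (Fintype.card G : ℝ) ^ ε :=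
      Real.rpow_le_rpow (by positivity) (hdi i) hε.le
    calc (tensorRank (matMulTensor ℂ (d i) (d i) (d i)) : ℝ)
        ≤ C * (d i : ℝ) ^ (2 + 2 * ε) := h1
      _ = C * ((d i : ℝ) ^ 2 * ((d i : ℝ) ^ 2) ^ ε) := by rw [h2]
      _ ≤ C * ((d i : ℝ) ^ 2 * (Fintype.card G : ℝ) ^ ε) :=
        mul_le_mul_of_nonneg_left (mul_le_mul_of_nonneg_left h3 (by positivity)) hC.le
      _ = C * (Fintype.card G : ℝ) ^ ε * (d i : ℝ) ^ 2 := by ring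
  have hsumR : ∑ i, (d i : ℝ) ^ 2 = Fintype.card G := by exact_mod_cast hsum
  calc (tensorRank (groupTensor ℂ G) : ℝ)
      ≤ ∑ i : Fin r, (tensorRank (matMulTensor ℂ (d i) (d i) (d i)) : ℝ) := by
        exact_mod_cast hblocks
    _ ≤ ∑ i : Fin r, C * (Fintype.card G : ℝ) ^ ε * (d i : ℝ) ^ 2 :=
        Finset.sum_le_sum fun i _ => hblock i
    _ = C * (Fintype.card G : ℝ) ^ ε * ∑ i : Fin r, (d i : ℝ) ^ 2 := by rw [Finset.mul_sum]
    _ = C * (Fintype.card G : ℝ) ^ ε * (Fintype.card G : ℝ) := by rw [hsumR]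
    _ = C * (Fintype.card G : ℝ) ^ (1 + ε) := by
        rw [Real.rpow_add hGpos, Real.rpow_one]; ring

end Summit.MatrixMultiplication.MatrixMultiplication.Theorems
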